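import Summits.PneNP.PneNP.Theorems.SymmetryBudgetWindowBarrierEntropyGame
import Literature.GroupTheory.PermutationGroups.SmallIndexSubgroups

/-!
# The block group is the even class-stabiliser; its index is at most `2^n · 2^{Kn}`
(dichotomy `WindowBarrier` stmt-PneNP-2145 / `NoHiddenOrder` stmt-PneNP-14781, route `PneNP/SymmetryBudget`)

`CosetGame.blockGroup μ` (`SymmetryBudgetWindowBarrierEntropyGame.lean`) is GENERATED by the equally-labelled
3-cycles.  For counting the positions of the entropy game (the cosets of `blockGroup μ`, which index
the gates of the completeness circuit) one needs it as a STABILISER: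

* `CosetGame.classStab μ` — the permutations preserving every label; `CosetGame.classSign μ i` — the
  sign of the action on the class `μ⁻¹ i` (through the tree's restriction homomorphism
  `Literature.GroupTheory.PermutationGroups.restr`); `CosetGame.evenStab μ` — the label-preserving
  permutations acting evenly on every class.
* **`CosetGame.blockGroup_eq_evenStab`**: `blockGroup μ = evenStab μ` (`≤`: a generator swaps twice
  inside one class; `≥`: induction on the support — peel off the component in the class of a moved
  point, an even permutation of that class, hence a product of 3-cycles of that class by
  `Equiv.Perm.closure_three_cycles_eq_alternating`, each of which is a generator by
  `IsThreeCycle.eq_swap_mul_swap_iff_mem_support`).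
* **`CosetGame.index_blockGroup_le`**: if `μ` has entropy `≤ K n` then
  `(blockGroup μ).index ≤ 2 ^ n * 2 ^ (K * n)` (`|classStab μ| = ∏ |class|!` by
  `DomMulAct.stabilizer_card'`, so `[Sym : classStab] · ∏ |class|! = n! ≤ 2^{Kn} ∏ |class|!`; and
  `[classStab : evenStab] ≤ 2^{#labels} ≤ 2^n`, the even ones being the kernel of the sign vector).
-/

-- `Summit.PneNP.PneNP.…` duplicates `PneNP` BY DESIGN (single-problem summit).
set_option linter.dupNamespace false

namespace Summit.PneNP.PneNP.Theorems

open Finset Equiv Equiv.Perm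
open Literature.GroupTheory.PermutationGroups (restr restr_apply_coe)

namespace CosetGame

variable {n : ℕ}

/-! ### The class stabiliser and the sign vector -/

/-- The permutations preserving every label of `μ`. -/
def classStab (μ : Fin n → ℕ) : Subgroup (Perm (Fin n)) where
  carrier := {a | ∀ u, μ (a u) = μ u}
  mul_mem' {a b} ha hb u := by rw [Perm.mul_apply, ha, hb]
  one_mem' u := rfl
  inv_mem' {a} ha u := by
    have h := ha (a⁻¹ u)
    have e : a (a⁻¹ u) = u := a.apply_symm_apply u
    rw [e] at h
    exact h.symm

/-- Membership in the class stabiliser. -/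
theorem mem_classStab_iff (μ : Fin n → ℕ) (a : Perm (Fin n)) : a ∈ classStab μ ↔ ∀ u, μ (a u) = μ u :=
  Iff.rfl

/-- The class `μ⁻¹ i` is invariant under the class stabiliser. -/
theorem classStab_invariant (μ : Fin n → ℕ) (i : ℕ) :
    ∀ s ∈ classStab μ, ∀ x, μ (s x) = i ↔ μ x = i := fun s hs x => by rw [hs x]

/-- Restriction of the class stabiliser to the class `μ⁻¹ i`. -/
def restrClass (μ : Fin n → ℕ) (i : ℕ) : classStab μ →* Perm {u // μ u = i} :=
  restr (classStab μ) (fun u => μ u = i) (classStab_invariant μ i)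

/-- The sign of the action on the class `μ⁻¹ i`. -/
def classSign (μ : Fin n → ℕ) (i : ℕ) : classStab μ →* ℤˣ :=
  Perm.sign.comp (restrClass μ i)

/-- The label-preserving permutations acting EVENLY on every class. -/
def evenStab (μ : Fin n → ℕ) : Subgroup (Perm (Fin n)) :=
  (⨅ i : ℕ, (classSign μ i).ker).map (classStab μ).subtype

/-- Membership in the even class stabiliser. -/
theorem mem_evenStab_iff (μ : Fin n → ℕ) (a : Perm (Fin n)) :
    a ∈ evenStab μ ↔ ∃ h : a ∈ classStab μ, ∀ i, classSign μ i ⟨a, h⟩ = 1 := by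
  constructor
  · rintro ⟨b, hb, rfl⟩
    refine ⟨b.2, fun i => ?_⟩
    have := (Subgroup.mem_iInf.1 hb) i
    rwa [MonoidHom.mem_ker] at this
  · rintro ⟨h, hsign⟩
    refine ⟨⟨a, h⟩, Subgroup.mem_iInf.2 fun i => ?_, rfl⟩
    rw [MonoidHom.mem_ker]
    exact hsign i

/-- A swap of two equally labelled points preserves the labels. -/
theorem swap_mem_classStab {μ : Fin n → ℕ} {u v : Fin n} (h : μ u = μ v) : swap u v ∈ classStab μ := by
  intro x
  rcases eq_or_ne x u with rfl | hxu
  · rw [swap_apply_left, h]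
  rcases eq_or_ne x v with rfl | hxv
  · rw [swap_apply_right, h]
  rw [swap_apply_of_ne_of_ne hxu hxv]

/-- The restriction of a swap inside the class `i` is a swap; outside it is the identity; either way
its sign on the class `j` is `-1` iff `j = i`.  Recorded as: the sign on class `j` of `swap u v`
(`μ u = μ v = i`) is `-1` if `j = i` and `1` otherwise. -/
theorem classSign_swap {μ : Fin n → ℕ} {u v : Fin n} (huv : u ≠ v) (hu : μ u = μ v) (j : ℕ) :
    classSign μ j ⟨swap u v, swap_mem_classStab hu⟩ = if j = μ u then -1 else 1 := by
  unfold classSign restrClass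
  rw [MonoidHom.comp_apply]
  split_ifs with hj
  · -- the restriction is the swap of `⟨u⟩` and `⟨v⟩`
    have hres : restr (classStab μ) (fun x => μ x = j) (classStab_invariant μ j)
        ⟨swap u v, swap_mem_classStab hu⟩ = swap ⟨u, hj ▸ rfl⟩ ⟨v, hj ▸ hu.symm ▸ rfl⟩ := by
      ext x
      rw [restr_apply_coe]
      rcases eq_or_ne (x : Fin n) u with hxu | hxu
      · have : x = ⟨u, hj ▸ rfl⟩ := Subtype.ext hxu
        rw [this, swap_apply_left, swap_apply_left]
      rcases eq_or_ne (x : Fin n) v with hxv | hxv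
      · have : x = ⟨v, hj ▸ hu.symm ▸ rfl⟩ := Subtype.ext hxv
        rw [this, swap_apply_right, swap_apply_right]
      rw [swap_apply_of_ne_of_ne hxu hxv, swap_apply_of_ne_of_ne]
      · exact fun h => hxu (congrArg Subtype.val h)
      · exact fun h => hxv (congrArg Subtype.val h)
    rw [hres, sign_swap]
    exact fun h => huv (congrArg Subtype.val h)
  · -- the restriction is the identity
    have hres : restr (classStab μ) (fun x => μ x = j) (classStab_invariant μ j)
        ⟨swap u v, swap_mem_classStab hu⟩ = 1 := by
      ext x
      rw [restr_apply_coe, Perm.one_apply]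
      have hxu : (x : Fin n) ≠ u := fun h => hj (x.2.symm.trans (congrArg μ h))
      have hxv : (x : Fin n) ≠ v := fun h => hj (x.2.symm.trans ((congrArg μ h).trans hu.symm))
      rw [swap_apply_of_ne_of_ne hxu hxv]
    rw [hres, Perm.sign_one]

/-! ### `blockGroup μ = evenStab μ` -/

/-- Generators are even class-stabilising: `blockGroup μ ≤ evenStab μ`. -/
theorem blockGroup_le_evenStab (μ : Fin n → ℕ) : blockGroup μ ≤ evenStab μ := by
  refine (Subgroup.closure_le _).2 ?_
  rintro σ ⟨u, v, w, huv, hvw, huw, h1, h2, rfl⟩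
  rw [SetLike.mem_coe, mem_evenStab_iff]
  have hm : swap u v * swap v w ∈ classStab μ :=
    (classStab μ).mul_mem (swap_mem_classStab h1) (swap_mem_classStab h2)
  refine ⟨hm, fun i => ?_⟩
  have hprod : (⟨swap u v * swap v w, hm⟩ : classStab μ) =
      ⟨swap u v, swap_mem_classStab h1⟩ * ⟨swap v w, swap_mem_classStab h2⟩ := rfl
  rw [hprod, map_mul, classSign_swap huv h1, classSign_swap hvw h2, ← h1]
  split_ifs <;> simp

/-- An even permutation of one class, extended by the identity, lies in the block group (it is a
product of 3-cycles of that class, and those are generators). -/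
theorem ofSubtype_mem_blockGroup (μ : Fin n → ℕ) (i : ℕ) (t : Perm {u // μ u = i}) (ht : sign t = 1) :
    ofSubtype t ∈ blockGroup μ := by
  classical
  have hmem : t ∈ Subgroup.closure {σ : Perm {u // μ u = i} | IsThreeCycle σ} := by
    rw [closure_three_cycles_eq_alternating]
    exact Perm.mem_alternatingGroup.2 ht
  have hmap : ofSubtype t ∈ (Subgroup.closure {σ : Perm {u // μ u = i} | IsThreeCycle σ}).map
      (ofSubtype : Perm {u // μ u = i} →* Perm (Fin n)) := Subgroup.mem_map_of_mem _ hmem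
  rw [MonoidHom.map_closure] at hmap
  refine (Subgroup.closure_le _).2 ?_ hmap
  rintro g ⟨τ, hτ, rfl⟩
  have hτ' : IsThreeCycle (ofSubtype τ : Perm (Fin n)) := by
    rw [IsThreeCycle, cycleType_ofSubtype]; exact hτ
  -- a point of the support, necessarily in the class
  obtain ⟨x, hx⟩ : (ofSubtype τ : Perm (Fin n)).support.Nonempty := by
    rw [Finset.nonempty_iff_ne_empty, Ne, support_eq_empty_iff]
    exact hτ'.isCycle.ne_one
  have hcls : ∀ y ∈ (ofSubtype τ : Perm (Fin n)).support, μ y = i := fun y hy => by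
    obtain ⟨hy, -⟩ := (mem_support_ofSubtype y τ).1 hy
    exact hy
  have hx1 : (ofSubtype τ : Perm (Fin n)) x ∈ (ofSubtype τ : Perm (Fin n)).support :=
    apply_mem_support.2 hx
  have hx2 : (ofSubtype τ : Perm (Fin n)) ((ofSubtype τ : Perm (Fin n)) x) ∈
      (ofSubtype τ : Perm (Fin n)).support := apply_mem_support.2 hx1
  have hnd := (hτ'.nodup_iff_mem_support (a := x)).2 hx
  have heq := (hτ'.eq_swap_mul_swap_iff_mem_support (a := x)).2 hx
  simp only [List.nodup_cons, List.mem_cons, List.not_mem_nil, or_false,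
    not_or, List.nodup_nil, and_true] at hnd
  obtain ⟨⟨h12, h13⟩, h23, -⟩ := hnd
  exact Subgroup.subset_closure ⟨x, _, _, h12, h23, h13, (hcls x hx).trans (hcls _ hx1).symm,
    (hcls _ hx1).trans (hcls _ hx2).symm, heq⟩

/-- Even class-stabilising permutations are in the block group: `evenStab μ ≤ blockGroup μ`
(induction on the support). -/
theorem evenStab_le_blockGroup (μ : Fin n → ℕ) : evenStab μ ≤ blockGroup μ := by
  classical
  suffices key : ∀ (k : ℕ) (a : Perm (Fin n)), a ∈ evenStab μ → a.support.card ≤ k → a ∈ blockGroup μ from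
    fun a ha => key _ a ha le_rfl
  intro k
  induction k with
  | zero =>
    intro a _ hk
    have : a = 1 := support_eq_empty_iff.1 (Finset.card_eq_zero.1 (Nat.le_zero.1 hk))
    rw [this]; exact (blockGroup μ).one_mem
  | succ k ih =>
    intro a ha hk
    by_cases h0 : a.support = ∅
    · rw [support_eq_empty_iff.1 h0]; exact (blockGroup μ).one_mem
    obtain ⟨u, hu⟩ := Finset.nonempty_iff_ne_empty.2 h0
    obtain ⟨hac, hsign⟩ := (mem_evenStab_iff μ a).1 ha
    set i := μ u with hi
    -- the component of `a` in the class of `u`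
    set t : Perm {x // μ x = i} := restrClass μ i ⟨a, hac⟩ with ht
    have htsign : sign t = 1 := hsign i
    have hb : ofSubtype t ∈ blockGroup μ := ofSubtype_mem_blockGroup μ i t htsign
    have hb_in : ∀ x, μ x = i → (ofSubtype t : Perm (Fin n)) x = a x := fun x hx => by
      rw [ofSubtype_apply_of_mem t hx]; rfl
    have hb_out : ∀ x, μ x ≠ i → (ofSubtype t : Perm (Fin n)) x = x := fun x hx =>
      ofSubtype_apply_of_not_mem t hx
    -- peel it off
    set a' := (ofSubtype t)⁻¹ * a with ha'
    have ha'mem : a' ∈ evenStab μ :=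
      (evenStab μ).mul_mem ((evenStab μ).inv_mem (blockGroup_le_evenStab μ hb)) ha
    have hsupp : a'.support ⊆ a.support.erase u := by
      intro x hx
      rw [mem_support] at hx
      rw [Finset.mem_erase, mem_support]
      by_cases hxi : μ x = i
      · exfalso; apply hx
        rw [ha', Perm.mul_apply, Perm.inv_eq_iff_eq, hb_in x hxi]
      · have hax : μ (a x) ≠ i := fun h => hxi ((hac x).symm.trans h)
        have e : a' x = a x := by rw [ha', Perm.mul_apply, Perm.inv_eq_iff_eq, hb_out (a x) hax]
        refine ⟨fun hxu => hxi (hxu ▸ hi.symm), ?_⟩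
        rwa [e] at hx
    have hcard : a'.support.card ≤ k := by
      have h1 := Finset.card_le_card hsupp
      rw [Finset.card_erase_of_mem hu] at h1
      omega
    have ha'bg : a' ∈ blockGroup μ := ih a' ha'mem hcard
    have : a = ofSubtype t * a' := by rw [ha', mul_inv_cancel_left]
    rw [this]
    exact (blockGroup μ).mul_mem hb ha'bg

/-- **The block group is the even class-stabiliser.** -/
theorem blockGroup_eq_evenStab (μ : Fin n → ℕ) : blockGroup μ = evenStab μ :=
  le_antisymm (blockGroup_le_evenStab μ) (evenStab_le_blockGroup μ)

/-! ### The index bound -/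

/-- `|classStab μ| = ∏ |class|!` (`DomMulAct.stabilizer_card'`). -/
theorem card_classStab (μ : Fin n → ℕ) :
    Nat.card (classStab μ) = ∏ i ∈ univ.image μ, ((univ.filter fun u : Fin n => μ u = i).card).factorial := by
  classical
  have h1 : Nat.card (classStab μ) = Fintype.card {g : Perm (Fin n) // μ ∘ g = μ} := by
    rw [Nat.card_eq_fintype_card]
    refine Fintype.card_congr (Equiv.subtypeEquivRight fun g => ?_)
    change (∀ u, μ (g u) = μ u) ↔ μ ∘ g = μ
    exact ⟨fun h => funext h, fun h u => congrFun h u⟩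
  rw [h1, DomMulAct.stabilizer_card']
  refine Finset.prod_congr rfl fun i _ => ?_
  rw [Fintype.card_subtype]

/-- `[Sym(n) : classStab μ] ≤ 2^{Kn}` for `μ` of entropy `≤ K n`. -/
theorem index_classStab_le {K : ℕ} {μ : Fin n → ℕ} (h : IsLowEntropy K μ) :
    (classStab μ).index ≤ 2 ^ (K * n) := by
  have hmul := (classStab μ).index_mul_card
  rw [card_classStab, Nat.card_perm, Nat.card_eq_fintype_card, Fintype.card_fin] at hmul
  have hpos : 0 < ∏ i ∈ univ.image μ, ((univ.filter fun u : Fin n => μ u = i).card).factorial :=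
    Finset.prod_pos fun i _ => Nat.factorial_pos _
  refine Nat.le_of_mul_le_mul_right ?_ hpos
  rw [hmul]
  exact h

/-- `[classStab μ : evenStab μ] ≤ 2^n`: the even ones are the kernel of the sign vector over the (at
most `n`) labels. -/
theorem index_iInf_ker_classSign_le (μ : Fin n → ℕ) :
    (⨅ i : ℕ, (classSign μ i).ker).index ≤ 2 ^ n := by
  classical
  -- the sign vector over the labels that occur
  let Φ : classStab μ →* (↥(univ.image μ) → ℤˣ) := MonoidHom.pi fun i => classSign μ (i : ℕ)
  have hker : Φ.ker ≤ ⨅ i : ℕ, (classSign μ i).ker := by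
    intro a ha
    rw [MonoidHom.mem_ker] at ha
    refine Subgroup.mem_iInf.2 fun i => ?_
    rw [MonoidHom.mem_ker]
    by_cases hi : i ∈ univ.image μ
    · exact congrFun ha ⟨i, hi⟩
    · -- empty class: its permutation group is trivial
      have hsub : Subsingleton (Perm {u // μ u = i}) := by
        refine ⟨fun x y => Perm.ext fun z => ?_⟩
        exact absurd (mem_image_of_mem μ (mem_univ (z : Fin n))) (z.2 ▸ hi :)
      unfold classSign
      rw [MonoidHom.comp_apply, Subsingleton.elim (restrClass μ i a) 1, Perm.sign_one]
  calc (⨅ i : ℕ, (classSign μ i).ker).index ≤ Φ.ker.index := Subgroup.index_antitone hker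
    _ = Nat.card Φ.range := Subgroup.index_ker Φ
    _ ≤ Nat.card (↥(univ.image μ) → ℤˣ) := Nat.card_le_card_of_injective _ Subtype.val_injective
    _ = 2 ^ (univ.image μ).card := by
        rw [Nat.card_eq_fintype_card, Fintype.card_fun, Fintype.card_units_int, Fintype.card_coe]
    _ ≤ 2 ^ n := Nat.pow_le_pow_right Nat.two_pos (by
        simpa using Finset.card_image_le (s := (univ : Finset (Fin n))) (f := μ))

/-- **Index bound for the block group**: for a labelling of entropy `≤ K n`,
`[Sym(n) : blockGroup μ] ≤ 2^n · 2^{Kn}` — so the entropy-`K` game has at most `2^{(K+1)n}`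
positions of each type. -/
theorem index_blockGroup_le {K : ℕ} {μ : Fin n → ℕ} (h : IsLowEntropy K μ) :
    (blockGroup μ).index ≤ 2 ^ n * 2 ^ (K * n) := by
  rw [blockGroup_eq_evenStab, evenStab, Subgroup.index_map_subtype]
  exact Nat.mul_le_mul (index_iInf_ker_classSign_le μ) (index_classStab_le h)

end CosetGame

end Summit.PneNP.PneNP.Theorems
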